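import Summits.AtomisticToContinuum.HydrodynamicLimit.Theorems.JParityClosureParityRigidityModulus
import Summits.AtomisticToContinuum.HydrodynamicLimit.Theorems.JParityClosureParityRigidityIdentify

/-!
# Collision-invariant characteristic functions, II: the phase (helper for `ParityRigidity`)

Let `m` be a probability measure with finite first moment on a finite-dimensional real inner
product space `E` of dimension `≥ 2` whose characteristic function `φ` is multiplicatively
collision invariant, `φ ξ φ η = φ ξ' φ η'` for every impact direction.  By the companion file
`JParityClosureParityRigidityModulus`, `‖φ ξ‖ = exp (-θ‖ξ‖²)`.  Here we show that the
renormalised function `χ ξ = φ ξ · exp (θ‖ξ‖²)` is a *character* of `E`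
(`mul_eq_of_collision_invariant`: two velocity pairs with equal momentum and energy are related by
a collision, plus orthogonal multiplicativity), and then that `χ ξ = exp (i⟪u, ξ⟫)` using the
derivative of `φ` at `0` (`eq_one_of_mul_of_hasDerivAt_zero`).  Consequently
`φ ξ = exp (i⟪u, ξ⟫) exp (-θ‖ξ‖²)` and `m` is a Dirac mass or a Maxwellian law
(`dirac_or_maxwellian_of_collision_invariant`).

Helper file for item stmt-AtomisticToContinuum-13084 (route JParityClosure, decl `ParityRigidity`).
-/

open MeasureTheory Metric Real Filter Topology Set Complex
open scoped InnerProductSpace ENNReal NNReal Topology ComplexConjugate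

namespace Summit.AtomisticToContinuum.HydrodynamicLimit.Theorems.ParityRigidity

open Literature.MathematicalPhysics.KineticTheory Literature.Analysis.FluidPDE

variable {E : Type*} [NormedAddCommGroup E] [InnerProductSpace ℝ E]

/-! ### Functional equation: collision invariance forces a character -/

section Functional

/-- In dimension `≥ 2` every vector admits an orthogonal unit vector. -/
theorem exists_norm_eq_one_inner_eq_zero (hE : 2 ≤ Module.finrank ℝ E) (P : E) :
    ∃ e : E, ‖e‖ = 1 ∧ ⟪P, e⟫_ℝ = 0 := by
  obtain ⟨e₁, e₂, he₁, he₂, he₁₂⟩ := exists_orthonormal_pair hE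
  set w : E := ⟪P, e₂⟫_ℝ • e₁ - ⟪P, e₁⟫_ℝ • e₂ with hw
  have hPw : ⟪P, w⟫_ℝ = 0 := by
    rw [hw, inner_sub_right, real_inner_smul_right, real_inner_smul_right]
    ring
  by_cases hw0 : w = 0
  · refine ⟨e₁, he₁, ?_⟩
    have h2 : ⟪w, e₂⟫_ℝ = -⟪P, e₁⟫_ℝ := by
      rw [hw, inner_sub_left, real_inner_smul_left, real_inner_smul_left, he₁₂,
        real_inner_self_eq_norm_sq, he₂]
      ring
    rw [hw0, inner_zero_left] at h2
    linarith
  · refine ⟨‖w‖⁻¹ • w, ?_, ?_⟩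
    · rw [norm_smul, norm_inv, norm_norm, inv_mul_cancel₀ (norm_ne_zero_iff.2 hw0)]
    · rw [real_inner_smul_right, hPw, mul_zero]

/-- Two velocity pairs `(a + q, a - q)` and `(a + q', a - q')` with `‖q‖ = ‖q'‖` (equal momentum
and energy) are related by a collision (dimension `≥ 2`). -/
theorem exists_collide_eq_of_norm_eq (hE : 2 ≤ Module.finrank ℝ E) (a : E) {q q' : E}
    (hqq : ‖q‖ = ‖q'‖) :
    ∃ ω : sphere (0 : E) 1, collide ω (a + q, a - q) = (a + q', a - q') := by
  by_cases h : q = q'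
  · subst h
    obtain ⟨e, he, hqe⟩ := exists_norm_eq_one_inner_eq_zero hE q
    refine ⟨⟨e, mem_sphere_zero_iff_norm.2 he⟩, ?_⟩
    have h0 : ⟪a + q - (a - q), e⟫_ℝ = 0 := by
      rw [show a + q - (a - q) = (2 : ℝ) • q by rw [two_smul]; abel, real_inner_smul_left, hqe,
        mul_zero]
    change (a + q - ⟪a + q - (a - q), e⟫_ℝ • e, a - q + ⟪a + q - (a - q), e⟫_ℝ • e) =
      (a + q, a - q)
    rw [h0, zero_smul, sub_zero, add_zero]
  · have hne : q - q' ≠ 0 := sub_ne_zero.2 h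
    have hn : ‖q - q'‖ ≠ 0 := norm_ne_zero_iff.2 hne
    refine ⟨⟨‖q - q'‖⁻¹ • (q - q'), by
      rw [mem_sphere_zero_iff_norm, norm_smul, norm_inv, norm_norm, inv_mul_cancel₀ hn]⟩, ?_⟩
    have hin : ⟪q, q - q'⟫_ℝ = ‖q - q'‖ ^ 2 / 2 := by
      have h1 : ‖q - q'‖ ^ 2 = ‖q‖ ^ 2 - 2 * ⟪q, q'⟫_ℝ + ‖q'‖ ^ 2 := norm_sub_sq_real q q'
      rw [inner_sub_right, real_inner_self_eq_norm_sq, h1, ← hqq]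
      ring
    have hcoef : ⟪a + q - (a - q), ‖q - q'‖⁻¹ • (q - q')⟫_ℝ • (‖q - q'‖⁻¹ • (q - q')) = q - q' := by
      rw [real_inner_smul_right, show a + q - (a - q) = (2 : ℝ) • q by rw [two_smul]; abel,
        real_inner_smul_left, hin, smul_smul]
      have : ‖q - q'‖⁻¹ * (2 * (‖q - q'‖ ^ 2 / 2)) * ‖q - q'‖⁻¹ = 1 := by
        field_simp
      rw [this, one_smul]
    change (a + q - ⟪a + q - (a - q), ‖q - q'‖⁻¹ • (q - q')⟫_ℝ • (‖q - q'‖⁻¹ • (q - q')),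
      a - q + ⟪a + q - (a - q), ‖q - q'‖⁻¹ • (q - q')⟫_ℝ • (‖q - q'‖⁻¹ • (q - q'))) =
      (a + q', a - q')
    rw [hcoef, Prod.mk.injEq]
    constructor <;> abel

variable {ψ : E → ℂ}

/-- Orthogonal multiplicativity of a collision-invariant function with `ψ 0 = 1`. -/
theorem mul_eq_of_inner_eq_zero (hψ0 : ψ 0 = 1)
    (H : ∀ (ω : sphere (0 : E) 1) (ξ η : E),
      ψ ξ * ψ η = ψ (collide ω (ξ, η)).1 * ψ (collide ω (ξ, η)).2)
    {a b : E} (hab : ⟪a, b⟫_ℝ = 0) : ψ (a + b) = ψ a * ψ b := by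
  by_cases hb : b = 0
  · subst hb
    simp [hψ0]
  have hn : ‖b‖ ≠ 0 := norm_ne_zero_iff.mpr hb
  obtain ⟨ω, hω⟩ : ∃ ω : sphere (0 : E) 1, (ω : E) = ‖b‖⁻¹ • b :=
    ⟨⟨‖b‖⁻¹ • b, by
      rw [mem_sphere_zero_iff_norm, norm_smul, norm_inv, norm_norm, inv_mul_cancel₀ hn]⟩, rfl⟩
  have key := H ω (a + b) 0
  rw [collide_add_zero_eq hab hb ω hω] at key
  simpa [hψ0] using key

/-- A collision-invariant `ψ` with `ψ 0 = 1` and `ψ q ψ (-q) = 1` satisfies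
`ψ ξ ψ η = ψ ((ξ + η)/2)²`: the product depends on the pair only through its momentum (pairs
with equal momentum and energy are related by a collision, and the energy dependence drops out
by orthogonal multiplicativity). -/
theorem mul_eq_sq_of_collision_invariant (hE : 2 ≤ Module.finrank ℝ E) (hψ0 : ψ 0 = 1)
    (H : ∀ (ω : sphere (0 : E) 1) (ξ η : E),
      ψ ξ * ψ η = ψ (collide ω (ξ, η)).1 * ψ (collide ω (ξ, η)).2)
    (hunit : ∀ q, ψ q * ψ (-q) = 1) (ξ η : E) :
    ψ ξ * ψ η = ψ ((1 / 2 : ℝ) • (ξ + η)) ^ 2 := by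
  set a : E := (1 / 2 : ℝ) • (ξ + η) with ha
  set q : E := (1 / 2 : ℝ) • (ξ - η) with hq
  have hξ : ξ = a + q := by
    rw [ha, hq, ← smul_add]
    have : ξ + η + (ξ - η) = (2 : ℝ) • ξ := by rw [two_smul]; abel
    rw [this, smul_smul]; norm_num
  have hη : η = a - q := by
    rw [ha, hq, ← smul_sub]
    have : ξ + η - (ξ - η) = (2 : ℝ) • η := by rw [two_smul]; abel
    rw [this, smul_smul]; norm_num
  clear_value a q
  obtain ⟨e, he, hae⟩ := exists_norm_eq_one_inner_eq_zero hE a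
  have hqq : ‖q‖ = ‖‖q‖ • e‖ := by rw [norm_smul, norm_norm, he, mul_one]
  obtain ⟨ω, hω⟩ := exists_collide_eq_of_norm_eq hE a hqq
  set q' : E := ‖q‖ • e with hq'
  have haq' : ⟪a, q'⟫_ℝ = 0 := by rw [hq', real_inner_smul_right, hae, mul_zero]
  have haq'' : ⟪a, -q'⟫_ℝ = 0 := by rw [inner_neg_right, haq', neg_zero]
  calc ψ ξ * ψ η = ψ (a + q) * ψ (a - q) := by rw [hξ, hη]
    _ = ψ (a + q') * ψ (a - q') := by
        have h := H ω (a + q) (a - q)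
        rw [hω] at h
        exact h
    _ = ψ a * ψ q' * (ψ a * ψ (-q')) := by
        rw [mul_eq_of_inner_eq_zero hψ0 H haq', sub_eq_add_neg, mul_eq_of_inner_eq_zero hψ0 H haq'']
    _ = ψ a ^ 2 * (ψ q' * ψ (-q')) := by ring
    _ = ψ a ^ 2 := by rw [hunit, mul_one]

/-- **Character.** A collision-invariant `ψ` with `ψ 0 = 1` and `ψ q ψ (-q) = 1` is
multiplicative: `ψ (ξ + η) = ψ ξ ψ η` (dimension `≥ 2`). -/
theorem mul_eq_of_collision_invariant (hE : 2 ≤ Module.finrank ℝ E) (hψ0 : ψ 0 = 1)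
    (H : ∀ (ω : sphere (0 : E) 1) (ξ η : E),
      ψ ξ * ψ η = ψ (collide ω (ξ, η)).1 * ψ (collide ω (ξ, η)).2)
    (hunit : ∀ q, ψ q * ψ (-q) = 1) (ξ η : E) : ψ (ξ + η) = ψ ξ * ψ η := by
  rw [mul_eq_sq_of_collision_invariant hE hψ0 H hunit ξ η]
  have h := mul_eq_sq_of_collision_invariant hE hψ0 H hunit (ξ + η) 0
  rwa [hψ0, mul_one, add_zero] at h

end Functional

/-! ### The characteristic function -/

section CharFun

variable [FiniteDimensional ℝ E] [MeasurableSpace E] [BorelSpace E]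
variable (m : Measure E) [IsProbabilityMeasure m]

omit [FiniteDimensional ℝ E] [BorelSpace E] in
/-- The renormalised characteristic function `χ ξ = φ ξ · exp (θ‖ξ‖²)` of a collision-invariant
`φ = charFun m` with `‖φ ξ‖ = exp (-θ‖ξ‖²)` is a character of `E`. -/
theorem charFun_mul_exp_add (hE : 2 ≤ Module.finrank ℝ E)
    (H : ∀ (ω : sphere (0 : E) 1) (ξ η : E), charFun m ξ * charFun m η =
      charFun m (collide ω (ξ, η)).1 * charFun m (collide ω (ξ, η)).2)
    {θ : ℝ} (hθ : ∀ ξ, ‖charFun m ξ‖ = Real.exp (-θ * ‖ξ‖ ^ 2)) (ξ η : E) :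
    charFun m (ξ + η) * (Real.exp (θ * ‖ξ + η‖ ^ 2) : ℂ) =
      charFun m ξ * (Real.exp (θ * ‖ξ‖ ^ 2) : ℂ) *
        (charFun m η * (Real.exp (θ * ‖η‖ ^ 2) : ℂ)) := by
  set ψ : E → ℂ := fun ξ => charFun m ξ * (Real.exp (θ * ‖ξ‖ ^ 2) : ℂ) with hψ
  have hψ0 : ψ 0 = 1 := by simp [hψ, charFun_zero]
  have Hψ : ∀ (ω : sphere (0 : E) 1) (ξ η : E),
      ψ ξ * ψ η = ψ (collide ω (ξ, η)).1 * ψ (collide ω (ξ, η)).2 := by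
    intro ω ξ η
    have h1 := H ω ξ η
    have h2 := norm_sq_collide_fst_add_norm_sq_collide_snd ω (ξ, η)
    have h3 : Real.exp (θ * ‖ξ‖ ^ 2) * Real.exp (θ * ‖η‖ ^ 2) =
        Real.exp (θ * ‖(collide ω (ξ, η)).1‖ ^ 2) * Real.exp (θ * ‖(collide ω (ξ, η)).2‖ ^ 2) := by
      rw [← Real.exp_add, ← Real.exp_add]
      congr 1
      linear_combination (-θ) * h2
    simp only [hψ]
    calc charFun m ξ * (Real.exp (θ * ‖ξ‖ ^ 2) : ℂ) * (charFun m η * (Real.exp (θ * ‖η‖ ^ 2) : ℂ))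
        = (charFun m ξ * charFun m η) *
            ((Real.exp (θ * ‖ξ‖ ^ 2) * Real.exp (θ * ‖η‖ ^ 2) : ℝ) : ℂ) := by push_cast; ring
      _ = (charFun m (collide ω (ξ, η)).1 * charFun m (collide ω (ξ, η)).2) *
            ((Real.exp (θ * ‖(collide ω (ξ, η)).1‖ ^ 2) *
              Real.exp (θ * ‖(collide ω (ξ, η)).2‖ ^ 2) : ℝ) : ℂ) := by rw [h1, h3]
      _ = _ := by push_cast; ring
  have hunit : ∀ q, ψ q * ψ (-q) = 1 := by
    intro q
    simp only [hψ, norm_neg, charFun_neg]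
    have h4 : ‖charFun m q‖ ^ 2 * (Real.exp (θ * ‖q‖ ^ 2) * Real.exp (θ * ‖q‖ ^ 2)) = 1 := by
      rw [hθ q, sq, ← Real.exp_add, ← Real.exp_add, ← Real.exp_add]
      have : -θ * ‖q‖ ^ 2 + -θ * ‖q‖ ^ 2 + (θ * ‖q‖ ^ 2 + θ * ‖q‖ ^ 2) = 0 := by ring
      rw [this, Real.exp_zero]
    calc charFun m q * (Real.exp (θ * ‖q‖ ^ 2) : ℂ) *
          (conj (charFun m q) * (Real.exp (θ * ‖q‖ ^ 2) : ℂ))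
        = (charFun m q * conj (charFun m q)) *
            ((Real.exp (θ * ‖q‖ ^ 2) * Real.exp (θ * ‖q‖ ^ 2) : ℝ) : ℂ) := by push_cast; ring
      _ = ((‖charFun m q‖ ^ 2 : ℝ) : ℂ) *
            ((Real.exp (θ * ‖q‖ ^ 2) * Real.exp (θ * ‖q‖ ^ 2) : ℝ) : ℂ) := by
          rw [Complex.mul_conj, Complex.normSq_eq_norm_sq, Complex.ofReal_pow]
      _ = ((‖charFun m q‖ ^ 2 * (Real.exp (θ * ‖q‖ ^ 2) * Real.exp (θ * ‖q‖ ^ 2)) : ℝ) : ℂ) := by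
          push_cast; ring
      _ = 1 := by rw [h4, Complex.ofReal_one]
  exact mul_eq_of_collision_invariant hE hψ0 Hψ hunit ξ η

/-- Derivative of the characteristic function along a ray through the origin:
`d/dt φ(t e) |_{t=0} = i ∫ ⟪y, e⟫ dm(y)` (finite first moment). -/
theorem hasDerivAt_charFun_smul (h1 : MemLp id 1 m) (e : E) :
    HasDerivAt (fun t : ℝ => charFun m (t • e)) (I * ((∫ y, ⟪y, e⟫_ℝ ∂m : ℝ) : ℂ)) 0 := by
  have h1' : MemLp id ((1 : ℕ) : ℝ≥0∞) m := by simpa using h1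
  have hdiff : Differentiable ℝ (charFun m) :=
    (contDiff_charFun h1').differentiable one_ne_zero
  have hF : HasFDerivAt (charFun m) (fderiv ℝ (charFun m) 0) ((fun t : ℝ => t • e) 0) := by
    simpa using (hdiff 0).hasFDerivAt
  have hline : HasDerivAt (fun t : ℝ => t • e) e 0 := by
    simpa using (hasDerivAt_id (0 : ℝ)).smul_const e
  have hcomp := hF.comp_hasDerivAt (0 : ℝ) hline
  have key : fderiv ℝ (charFun m) 0 e = I * ((∫ y, ⟪y, e⟫_ℝ ∂m : ℝ) : ℂ) := by
    have h := iteratedFDeriv_charFun (n := 1) (t := 0) h1' ![e]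
    rw [iteratedFDeriv_one_apply] at h
    simp only [Fin.prod_univ_one, Matrix.cons_val_zero, inner_zero_right, Complex.ofReal_zero,
      zero_mul, Complex.exp_zero, mul_one, pow_one] at h
    rw [h, integral_complex_ofReal]
  rw [← key]
  exact hcomp

/-- **Phase.** A collision-invariant characteristic function with Gaussian modulus
`‖φ ξ‖ = exp (-θ‖ξ‖²)` and finite first moment is `φ ξ = exp (i⟪u, ξ⟫) exp (-θ‖ξ‖²)`, with
`u` the mean of `m`. -/
theorem charFun_eq_of_collision_invariant (hE : 2 ≤ Module.finrank ℝ E) (h1 : MemLp id 1 m)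
    (H : ∀ (ω : sphere (0 : E) 1) (ξ η : E), charFun m ξ * charFun m η =
      charFun m (collide ω (ξ, η)).1 * charFun m (collide ω (ξ, η)).2)
    {θ : ℝ} (hθ : ∀ ξ, ‖charFun m ξ‖ = Real.exp (-θ * ‖ξ‖ ^ 2)) (ξ : E) :
    charFun m ξ = cexp ((⟪∫ y, y ∂m, ξ⟫_ℝ : ℂ) * I) * (Real.exp (-θ * ‖ξ‖ ^ 2) : ℂ) := by
  -- the character `χ` and the ray function `k`
  set χ : E → ℂ := fun ξ => charFun m ξ * (Real.exp (θ * ‖ξ‖ ^ 2) : ℂ) with hχ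
  have hχmul : ∀ a b : E, χ (a + b) = χ a * χ b := fun a b => charFun_mul_exp_add m hE H hθ a b
  have hχnorm : ∀ a : E, ‖χ a‖ = 1 := by
    intro a
    simp only [hχ, norm_mul, Complex.norm_real, Real.norm_eq_abs, abs_of_pos (Real.exp_pos _), hθ]
    rw [← Real.exp_add]
    have : -θ * ‖a‖ ^ 2 + θ * ‖a‖ ^ 2 = 0 := by ring
    rw [this, Real.exp_zero]
  have hχ0 : χ 0 = 1 := by simp [hχ, charFun_zero]
  set α : ℝ := ∫ y, ⟪y, ξ⟫_ℝ ∂m with hα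
  set k : ℝ → ℂ := fun t => χ (t • ξ) * cexp (-(t : ℂ) * (I * α)) with hk
  -- derivative of `χ` along the ray
  have hderχ : HasDerivAt (fun t : ℝ => χ (t • ξ)) (I * α) 0 := by
    have hA := hasDerivAt_charFun_smul m h1 ξ
    have hB : HasDerivAt (fun t : ℝ => (Real.exp (θ * ‖t • ξ‖ ^ 2) : ℂ)) 0 0 := by
      have h1' : HasDerivAt (fun t : ℝ => θ * ‖ξ‖ ^ 2 * t ^ 2) (θ * ‖ξ‖ ^ 2 * (2 * 0)) 0 := by
        have := (hasDerivAt_pow 2 (0 : ℝ)).const_mul (θ * ‖ξ‖ ^ 2)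
        simpa using this
      have h2' : HasDerivAt (fun t : ℝ => Real.exp (θ * ‖ξ‖ ^ 2 * t ^ 2)) 0 0 := by
        have := h1'.exp
        simpa using this
      have h3' : (fun t : ℝ => (Real.exp (θ * ‖t • ξ‖ ^ 2) : ℂ)) =
          fun t : ℝ => ((Real.exp (θ * ‖ξ‖ ^ 2 * t ^ 2) : ℝ) : ℂ) := by
        funext t
        rw [norm_smul, mul_pow, Real.norm_eq_abs, sq_abs]
        ring_nf
      rw [h3']
      exact h2'.ofReal_comp
    have hC := hA.mul hB
    refine hC.congr_deriv ?_
    rw [zero_smul, norm_zero, mul_zero, hα]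
    simp
  have hderk : HasDerivAt k 0 0 := by
    have hD : HasDerivAt (fun t : ℝ => cexp (-(t : ℂ) * (I * α))) (cexp (-(0 : ℝ) * (I * α)) *
        (-(1 : ℂ) * (I * α))) 0 := by
      have h := ((hasDerivAt_id (0 : ℝ)).ofReal_comp).neg.mul_const (I * (α : ℂ))
      exact h.cexp
    refine (hderχ.mul hD).congr_deriv ?_
    rw [zero_smul, hχ0]
    simp only [Complex.ofReal_zero, neg_zero, zero_mul, Complex.exp_zero, mul_one, one_mul]
    ring
  -- `k` is multiplicative on `[0, ∞)`, unimodular, with `k 0 = 1`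
  have hkmul : ∀ s t : ℝ, 0 ≤ s → 0 ≤ t → k (s + t) = k s * k t := by
    intro s t _ _
    simp only [hk]
    rw [add_smul, hχmul, Complex.ofReal_add]
    rw [show -((s : ℂ) + (t : ℂ)) * (I * α) = -(s : ℂ) * (I * α) + -(t : ℂ) * (I * α) by ring,
      Complex.exp_add]
    ring
  have hk1 : ∀ t : ℝ, 0 ≤ t → ‖k t‖ ≤ 1 := by
    intro t _
    simp only [hk, norm_mul, hχnorm, one_mul]
    rw [show -(t : ℂ) * (I * α) = ((-(t * α) : ℝ) : ℂ) * I by push_cast; ring,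
      Complex.norm_exp_ofReal_mul_I]
  have hk0 : k 0 = 1 := by simp [hk, hχ0]
  have hk1' : k 1 = 1 := eq_one_of_mul_of_hasDerivAt_zero hk1 hkmul hk0 hderk zero_le_one
  -- unwind
  simp only [hk, one_smul, Complex.ofReal_one] at hk1'
  have hexp : cexp (-(1 : ℂ) * (I * α)) ≠ 0 := Complex.exp_ne_zero _
  have hχξ : χ ξ = cexp ((α : ℂ) * I) := by
    have : χ ξ = χ ξ * cexp (-(1 : ℂ) * (I * α)) * cexp ((α : ℂ) * I) := by
      rw [mul_assoc, ← Complex.exp_add, show -(1 : ℂ) * (I * α) + α * I = 0 by ring,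
        Complex.exp_zero, mul_one]
    rw [this, hk1', one_mul]
  have hmean : α = ⟪∫ y, y ∂m, ξ⟫_ℝ := by
    have h := integral_inner (𝕜 := ℝ) (memLp_one_iff_integrable.1 h1) ξ
    simp only [id] at h
    rw [hα, real_inner_comm ξ (∫ y, y ∂m), ← h]
    congr 1
    funext y
    exact real_inner_comm _ _
  have hφ : charFun m ξ = χ ξ * (Real.exp (-θ * ‖ξ‖ ^ 2) : ℂ) := by
    simp only [hχ]
    rw [mul_assoc, ← Complex.ofReal_mul, ← Real.exp_add]
    have : θ * ‖ξ‖ ^ 2 + -θ * ‖ξ‖ ^ 2 = 0 := by ring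
    rw [this, Real.exp_zero, Complex.ofReal_one, mul_one]
  rw [hφ, hχξ, hmean]

/-- **Rigidity of collision-invariant laws.** A probability measure with finite first moment on
a real inner product space of dimension `≥ 2` whose characteristic function is multiplicatively
collision invariant is a Dirac mass or a Maxwellian law. -/
theorem dirac_or_maxwellian_of_collision_invariant (hE : 2 ≤ Module.finrank ℝ E)
    (h1 : MemLp id 1 m)
    (H : ∀ (ω : sphere (0 : E) 1) (ξ η : E), charFun m ξ * charFun m η =
      charFun m (collide ω (ξ, η)).1 * charFun m (collide ω (ξ, η)).2) :
    (∃ u : E, m = Measure.dirac u) ∨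
      ∃ T : ℝ, ∃ u : E, 0 < T ∧
        m = (volume : Measure E).withDensity fun v => ENNReal.ofReal (localMaxwellian 1 T u v) := by
  obtain ⟨θ, hθ0, hθ⟩ := exists_norm_charFun_eq_exp m hE H
  exact dirac_or_maxwellian_of_charFun_eq m hθ0 (∫ y, y ∂m)
    (fun ξ => charFun_eq_of_collision_invariant m hE h1 H hθ ξ)

end CharFun

end Summit.AtomisticToContinuum.HydrodynamicLimit.Theorems.ParityRigidity
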